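import Summits.Ventures.YMGap.RobustBall.OneStateStar
import Summits.Ventures.YMGap.RobustBall.OneStateLimit
import Summits.Ventures.YMGap.RobustBall.OneStateBoundary
import Summits.Ventures.YMGap.RobustBall.OneStateInvariant
import HarnessLib

/-!
# Venture YMGap, track ROBUST-BALL — ONE STATE, the MASTER form: unique DLR state = periodised torus limit (full
# sequence) = limit of every boundary condition (uniformly); massive, area law; translation invariant when the member is
# translation covariant

HONEST FRAMING. WHAT THIS IS: a venture file (cell `pub-ymgap`, track Y2 ROBUST-BALL, seat ds-3) assembling the ONE-STATE
chain of the track in single declarations: `oneState_master_of_perturbedMassGapAt` (every `d`, `N`, `β`, tier 1: the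
currencies of `OneState.lean` / `OneStateLimit.lean` (Van Hove join, full-sequence torus limit), `OneStateBoundary.lean`
(every boundary condition, uniformly) and `OneStateInvariant.lean` (translation invariance for translation-covariant
members) behind ONE existential `∃ μ`), and the `SU(2)` `ℤ⁴` cell of record `su2_oneState_master_upTo_oneThird` — for every
`0 ≤ β_W ≤ 1/3` and every member of the gauge-invariant tier-1 ball `MemBallZdG (3/125) (3/250) R`: ONE state `μ` which is
(i) the unique DLR state, (ii) the only infinite-volume limit point of the member's periodised torus states and their
FULL-SEQUENCE limit, (iii) the limit of the member's finite-volume Gibbs distributions with EVERY boundary field along every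
cofinal sequence of volumes, uniformly in the boundary field, (iv) an Osterwalder–Seiler MASSIVE state with
plaquette–plaquette decay, (v) an AREA-LAW state with one `(C, c)` per range `R`, and (vi) TRANSLATION INVARIANT whenever
the member's finite-volume Hamiltonians are translation covariant. WHAT THIS IS NOT: no new estimate; existence of the
string tension of `μ` is not claimed; lattice strong-coupling statements, nothing about the continuum limit or the Clay
Millennium problem.

References: H.-O. Georgii (2011), Thm. 4.17, Prop. 7.11, §5.1; S. Friedli, Y. Velenik (2017), Lemma 6.30; the track's
`OneState*.lean`, `PeriodisedDLR.lean`, `BoundaryLimitDLR.lean`, `PerturbedCovariance.lean`.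
-/

noncomputable section

open MeasureTheory Filter Topology Function
open Literature.Probability.LatticeModels hiding configShift configShift_apply
open Literature.MathematicalPhysics.QuantumLattice hiding torusNorm
open Literature.MathematicalPhysics.QuantumFieldTheory hiding ZdEdge Site
open Literature.Barriers.QuantumFields (IsMassiveState)

namespace Summit.Ventures.YMGap.RobustBall

variable {d N : ℕ}

/-- ★★★ **ONE STATE — MASTER FORM** (tier 1, every `d`, `N`, `β`). Let `(W, supp)` be a link potential on `ℤ^d` with
continuous gauge-invariant terms reading their own links, locally finite support of range `R`, and assume the mass gap
`PerturbedMassGapAt d N β W supp`. Then there is ONE probability measure `μ` such that: (i) `perturbedGibbsMeasures = {μ}`;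
(ii) the infinite-volume limit points of the member's PERIODISED torus states are `{μ}` and the torus expectations converge
to `μ` along the FULL sequence `L + 1 → ∞` on bounded continuous cylinder observables; (iii) the member's finite-volume Gibbs
distributions with EVERY boundary field converge to `μ` along every cofinal sequence of volumes on bounded continuous
observables, and uniformly in the boundary field; (iv) if the finite-volume Hamiltonians are translation covariant, `μ` is
translation invariant. [folklore] -/
theorem oneState_master_of_perturbedMassGapAt {β : ℝ} {W : Potential (ZdEdge d) (SUN N)}
    {supp : Finset (ZdEdge d) → Finset (Finset (ZdEdge d))} (hgap : PerturbedMassGapAt d N β W supp)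
    (hWc : ∀ X, Continuous (W X)) (hdep : ∀ X, DependsOn (W X) (↑X : Set (ZdEdge d)))
    (hg : ∀ X, IsZdGaugeInvariant (W X)) (hm : ∀ X, Measurable (W X)) (hb : ∀ X, ∃ C, ∀ U, |W X U| ≤ C)
    (hsupp : W.IsSupportedBy supp) {R : ℝ} (hrange : ∀ e, ∀ X ∈ supp {e}, e ∈ X → ∀ y ∈ X, ‖e.1 - y.1‖ ≤ R) :
    ∃ μ : Measure (LGConfig d (SUN N)),
      perturbedGibbsMeasures (d := d) (fundamentalRep (Fin N)) ((N : ℝ) * β) W supp = {μ} ∧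
      perturbedLimitPoints ((N : ℝ) * β) (periodisedFamily W supp hdep hg hm hb) = {μ} ∧
      (∀ (F : LGConfig d (SUN N) → ℝ) (S : Finset (ZdEdge d)), IsCylinder F S → Continuous F → (∃ C, ∀ U, |F U| ≤ C) →
        Tendsto (fun L : ℕ => (periodisedFamily W supp hdep hg hm hb L).expectation (fundamentalRep (Fin N)) ((N : ℝ) * β)
          (toTorusObservable (L + 1) F)) atTop (𝓝 (∫ U, F U ∂μ))) ∧
      (∀ Λs : ℕ → Finset (ZdEdge d), (∀ Δ : Finset (ZdEdge d), ∀ᶠ n in atTop, Δ ⊆ Λs n) →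
        (∀ (ηs : ℕ → LGConfig d (SUN N)) (F : LGConfig d (SUN N) → ℝ), Continuous F → (∃ C, ∀ U, |F U| ≤ C) →
          Tendsto (fun n => ∫ U, F U ∂(perturbedYM (fundamentalRep (Fin N)) ((N : ℝ) * β) W supp (Λs n) (ηs n)))
            atTop (𝓝 (∫ U, F U ∂μ))) ∧
        ∀ (F : LGConfig d (SUN N) → ℝ), Continuous F → (∃ C, ∀ U, |F U| ≤ C) → ∀ ε : ℝ, 0 < ε →
          ∀ᶠ n in atTop, ∀ η : LGConfig d (SUN N),
            |∫ U, F U ∂(perturbedYM (fundamentalRep (Fin N)) ((N : ℝ) * β) W supp (Λs n) η) - ∫ U, F U ∂μ| < ε) ∧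
      ((∀ (Λ : Finset (ZdEdge d)) (v : Site d) (U : LGConfig d (SUN N)),
          hamiltonianIn W supp (Λ.map (edgeShift v).toEmbedding) (configShift v U) = hamiltonianIn W supp Λ U) →
        IsZdTranslationInvariant μ) := by
  obtain ⟨hsub, ⟨μ, hμ⟩⟩ := hgap.1
  have hG : perturbedGibbsMeasures (d := d) (fundamentalRep (Fin N)) ((N : ℝ) * β) W supp = {μ} :=
    Set.eq_singleton_iff_unique_mem.2 ⟨hμ, fun ν hν => hsub hν hμ⟩
  have hdlr : ∀ ν ∈ perturbedLimitPoints ((N : ℝ) * β) (periodisedFamily W supp hdep hg hm hb),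
      ν ∈ perturbedGibbsMeasures (d := d) (fundamentalRep (Fin N)) ((N : ℝ) * β) W supp := fun ν hν =>
    mem_perturbedGibbsMeasures_of_mem_perturbedLimitPoints hdep hg hm hb hsupp hWc hrange _ hν
  obtain ⟨μB, hGB, hB⟩ := boundaryLimit_of_perturbedMassGapAt hgap hWc hdep hsupp
  have hμB : μB = μ := by
    have h := Set.mem_singleton μB
    rw [← hGB, hG] at h
    exact h
  subst hμB
  refine ⟨μB, hG, Set.eq_singleton_iff_unique_mem.2 ⟨?_, fun ν hν => hsub (hdlr ν hν) hμ⟩, ?_, hB, fun hH => ?_⟩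
  · obtain ⟨ν, hν⟩ := perturbedLimitPoints_nonempty ((N : ℝ) * β) (periodisedFamily W supp hdep hg hm hb)
    rwa [← hsub (hdlr ν hν) hμ]
  · exact fun F S hFS hFc hFb =>
      tendsto_expectation_periodisedFamily_of_subsingleton hdep hg hm hb hsupp hWc hrange _ hsub hμ hFS hFc hFb
  · exact Covariance.isZdTranslationInvariant_of_subsingleton_perturbedYM _ (continuous_fundamentalRep (Fin N)) _ hWc
      hdep hsupp hH hsub hμ

/-- ★★★ **`SU(2)`, `ℤ⁴`, THE ONE STATE OF RECORD UP TO `β_W = 1/3`, HYPOTHESIS-FREE.** For each range `R` there is one pair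
`(C, c)`, `c > 0`, such that for EVERY `0 ≤ β_W ≤ 1/3` and EVERY member `(W, supp)` of the gauge-invariant tier-1 ball
`MemBallZdG (3/125) (3/250) R` added to `SU(2)` Wilson at `β_W` there is ONE probability measure `μ` on `SU(2)^{links(ℤ⁴)}`:
(i) the unique DLR state; (ii) the only infinite-volume limit point of the member's periodised torus states, and their
full-sequence limit on bounded continuous cylinder observables; (iii) the limit of the member's finite-volume Gibbs
distributions with EVERY boundary field along every cofinal sequence of volumes, uniformly in the boundary field;
(iv) MASSIVE with exponentially decaying plaquette–plaquette correlations; (v) AREA LAW `|⟨W_{R'×T}⟩_μ| ≤ C^{2(R'+T)} e^{-c R'T}`;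
(vi) TRANSLATION INVARIANT whenever the member's finite-volume Hamiltonians are translation covariant (ds-2's
`su2_massGapOnBallZdG_star_upTo_oneThird`, rb-p2's UpTo area law, ds-3's join / boundary / covariance chain). [folklore] -/
theorem su2_oneState_master_upTo_oneThird (R : ℕ) :
    ∃ C c : ℝ, 0 < c ∧ ∀ βW : ℝ, 0 ≤ βW → βW ≤ 1 / 3 →
      ∀ (W : Potential (ZdEdge 4) (SUN 2)) (supp : Finset (ZdEdge 4) → Finset (Finset (ZdEdge 4)))
      (hmem : MemBallZdG (3 / 125) (3 / 250) R W supp) (hdep : ∀ X, DependsOn (W X) (↑X : Set (ZdEdge 4)))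
      (hg : ∀ X, IsZdGaugeInvariant (W X)) (hm : ∀ X, Measurable (W X)) (hb : ∀ X, ∃ C, ∀ U, |W X U| ≤ C),
      ∃ μ : Measure (LGConfig 4 (SUN 2)),
        perturbedGibbsMeasures (d := 4) (fundamentalRep (Fin 2)) (((2 : ℕ) : ℝ) * (βW / 4)) W supp = {μ} ∧
        perturbedLimitPoints (((2 : ℕ) : ℝ) * (βW / 4)) (periodisedFamily W supp hdep hg hm hb) = {μ} ∧
        (∀ (F : LGConfig 4 (SUN 2) → ℝ) (S : Finset (ZdEdge 4)), IsCylinder F S → Continuous F → (∃ C, ∀ U, |F U| ≤ C) →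
          Tendsto (fun L : ℕ => (periodisedFamily W supp hdep hg hm hb L).expectation (fundamentalRep (Fin 2))
            (((2 : ℕ) : ℝ) * (βW / 4)) (toTorusObservable (L + 1) F)) atTop (𝓝 (∫ U, F U ∂μ))) ∧
        (∀ Λs : ℕ → Finset (ZdEdge 4), (∀ Δ : Finset (ZdEdge 4), ∀ᶠ n in atTop, Δ ⊆ Λs n) →
          (∀ (ηs : ℕ → LGConfig 4 (SUN 2)) (F : LGConfig 4 (SUN 2) → ℝ), Continuous F → (∃ C, ∀ U, |F U| ≤ C) →
            Tendsto (fun n => ∫ U, F U ∂(perturbedYM (fundamentalRep (Fin 2)) (((2 : ℕ) : ℝ) * (βW / 4)) W supp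
              (Λs n) (ηs n))) atTop (𝓝 (∫ U, F U ∂μ))) ∧
          ∀ (F : LGConfig 4 (SUN 2) → ℝ), Continuous F → (∃ C, ∀ U, |F U| ≤ C) → ∀ ε : ℝ, 0 < ε →
            ∀ᶠ n in atTop, ∀ η : LGConfig 4 (SUN 2),
              |∫ U, F U ∂(perturbedYM (fundamentalRep (Fin 2)) (((2 : ℕ) : ℝ) * (βW / 4)) W supp (Λs n) η) -
                ∫ U, F U ∂μ| < ε) ∧
        IsMassiveState μ ∧ HasExponentialDecay (plaquetteCorrFn (fundamentalRep (Fin 2)) μ) ∧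
        HasAreaLawWith μ (fun g => normalisedCharacter 2 (fundamentalRep (Fin 2) g)) C c ∧
        ((∀ (Λ : Finset (ZdEdge 4)) (v : Site 4) (U : LGConfig 4 (SUN 2)),
            hamiltonianIn W supp (Λ.map (edgeShift v).toEmbedding) (configShift v U) = hamiltonianIn W supp Λ U) →
          IsZdTranslationInvariant μ) := by
  obtain ⟨C, c, hc, hA⟩ := su2_oneState_star_upTo_oneThird R
  refine ⟨C, c, hc, fun βW h0 h W supp hmem hdep hg hm hb => ?_⟩
  obtain ⟨μ, hG, hL, hM, hD, hAL⟩ := hA βW h0 h W supp hmem hdep hg hm hb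
  have hgap : PerturbedMassGapAt 4 2 (βW / 4) W supp := su2_massGapOnBallZdG_star_upTo_oneThird h0 h R W supp hmem
  obtain ⟨μ', hG', -, hT, hB, hI⟩ := oneState_master_of_perturbedMassGapAt hgap hmem.continuous hdep hg hm hb
    hmem.supportedBy hmem.range
  have hμ' : μ' = μ := by
    have h1 := Set.mem_singleton μ'
    rw [← hG', hG] at h1
    exact h1
  subst hμ'
  exact ⟨μ', hG, hL, hT, hB, hM, hD, hAL, hI⟩

end Summit.Ventures.YMGap.RobustBall

end
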